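import Summits.QuantumFields.BalabanUV.Beta.GAN24.WSlotCauchyThree
import Summits.QuantumFields.BalabanUV.Beta.GAN24.WSlotThree
import Summits.QuantumFields.BalabanUV.Beta.MixedJetTablesPlug

/-!
# `BalabanUV.Beta.GAN24.WSlotMixedShape` — binder row G-an2-4 / (CONV-C), W-slot: the MIXED-TABLE hypotheses of the W-slot ENDs
# DISCHARGED for an1's concrete mixed binder table `mixFFAt` — for the cell's family the W-rows wait on the T₂ SLOT AND NOTHING ELSE

NOT IN PRINT; OUR PROOF ATTEMPT (G-an2-4 formalisation swarm, idle leaf seat `b2b-balaban-gan24-formalise-leaf-11`, gen 17; the typer's v3.10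
banner item «the mixed-shape one-liner»; module name PROVISIONAL — the row owner gan24-p1 may rename or re-home it).  HONEST FRAMING (cell
contract, verbatim): «discharging `BetaPertH` makes Bałaban's UV stability UNCONDITIONAL — a real constructive-QFT result; it is NOT the continuum
limit and NOT the Clay problem.»  HONEST DEPENDENCY (verbatim): «continuum YM on T⁴ ⇐ BetaPertH ∧ nine spine estimates (0/9 proved); BetaPertH ⇐
(D1) ∧ (D4) ∧ CAP+tail; G-an2-4 gates asym, D1 and NE2/3/4.»
[folklore] composition, every input BY NAME.  FINDING recorded here in the kernel: the «mixed-table shape» listed as OPEN in the swarm's records is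
an1's TREE THEOREM — `AveragingMixedJetTables.biLoc_mixFFAt` (every `d`, every rate, any box root), packaged by an1's plug as
`MixedJetTablesPlug.hmix_an1 : ∃ C δ, 0 < δ ∧ LocStencilFM Lc (mixFFAt (toSite r) Lc) C δ`; the field–field SUPPORT hypotheses `hfm`/`hm` of the
W-slot ENDs are an1's `mixFFAt_inl_inr` / `mixFFAt_inr`.  Plugging these into leaf-07's ENDs (`WSlotOfShapes.hW_of_shapes`,
`WSlotCauchyOfShapes.hWall_of_shapes` / `hW_hWall_of_shapes`, `WSlotThree.hW_three_of_T2Shape`, `WSlotCauchyThree.hW_hWall_three_of_T2ShapeDrift` /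
`…_of_T2ShapeSupRate`) gives, for an2's family `W := WbalOf d Lc cE cVH cΛ T₂ (mixFFAt (toSite r) Lc)` — ANY bi-stencil binder family `T₂`, in
particular an2's Stage-B `T2Of … (vh₂SAt (toSite r) Lc) (mixFFAt (toSite r) Lc)` (`WbalT2Of`, §3, by `rfl`) — BOTH W-rows of the D1-wall countdown
(`StencilSlotWallThree.d1Drift_JsBalOf_iff_three_of_wRows`: `hW₂`, `hW₂all`, `hδW`, `hθW0`, `hθW1`) from «T2Shape» ∧ («T2Drift» | «T2SupRate») ALONE.
No estimate, no cited fact, no `def`, no `Prop` mirror.  The wall composition itself stays the ROW OWNER's to file.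
NOTHING of the wall is discharged unconditionally: «T2Shape» / «T2Drift» / «T2SupRate» (the `j`-uniform locality and the all-scales drift / one-step
sup-norm rate of the NORMALISED bi-stencil tables `unitS₂ (sfStep Lc j) (smStep d Lc j) (T₂ j)`) are NOT IN PRINT, OPEN (road «W3»), asserted
nowhere.  0 wall binders instantiated.  NEVER «W-slot closed», NEVER «G-an2-4 closed».  NOT summit progress.

## What is proved
§1 (generic `d`, `1 ≤ Lc`, box root `r`): `mixFFAt_hfm`, `mixFFAt_hm` (the support hypotheses in the ENDs' binder shape); `hW_an1_of_shapes`,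
   `hWall_an1_of_shapes`, `hW_hWall_an1_of_shapes` = leaf-07's generic ENDs with `(hmix, hδ₄, hfm, hm)` DISCHARGED at `mixFF := mixFFAt (toSite r) Lc`.
§2 (`d = 3`, `2 ≤ Lc`): `hW_three_an1_of_T2Shape`, `hW_hWall_three_an1_of_T2ShapeDrift`, `hW_hWall_three_an1_of_T2ShapeSupRate` — K-slot and
   «E3Shape» ∧ «E3Drift» inside (road P1 / road S3 BY NAME through leaf-07's d = 3 ENDs).
§3 (`d = 3`, `2 ≤ Lc`): the same read on an2's Stage-B family `WbalT2Of … (vh₂S := vh₂SAt (toSite r) Lc) (mixFF := mixFFAt (toSite r) Lc)`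
   (`T₂ := T2Of …`, by `rfl`) and at the CENTRED root `ctrOff (3+1) Lc` of `MixedJetTablesPlug.JsBalAn1Ctr` (`ctrOff_mem_box`).
-/

noncomputable section

open Literature.MathematicalPhysics.QuantumFieldTheory
open Literature.MathematicalPhysics.QuantumFieldTheory.Balaban1983to89
open Literature.MathematicalPhysics.QuantumFieldTheory.Balaban1983to89.Beta
open AffineAveraging (box toSite)
open AveragingContoursRooted (ctrOff ctrOff_mem_box)
open AveragingMixedJetTables (mixFFAt vh₂SAt mixFFAt_inl_inr mixFFAt_inr)
open ExpKernelCalculus (MKer VertexFamily₂)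
open OneStepResolventKernel (Fib LocStencil)
open BalabanStepJetsSucc (wE e3Of)
open BalabanCompositeJets (LocStencil₂)
open SecondOrderResponse (LocStencilFM)
open BalabanStepW2 (WbalOf T2Of WbalT2Of)
open Summit.QuantumFields.BalabanUV.Beta.HessKerDressedUnits (unitS unitW)
open Summit.QuantumFields.BalabanUV.Beta.SecondOrderUnits (unitS₂)
open Summit.QuantumFields.BalabanUV.Beta.MixedJetTablesPlug (hmix_an1)
open Summit.QuantumFields.BalabanUV.Beta.GAN24.CombesThomas (sfStep smStep UnitDecayK CauchyDecayK SupBound)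
open Summit.QuantumFields.BalabanUV.Beta.GAN24.StencilSlotOfE3 (one_le_of_two_le)
open Summit.QuantumFields.BalabanUV.Beta.GAN24.WSlotOfShapes (hW_of_shapes)
open Summit.QuantumFields.BalabanUV.Beta.GAN24.WSlotCauchyOfShapes (hWall_of_shapes hW_hWall_of_shapes)
open Summit.QuantumFields.BalabanUV.Beta.GAN24.WSlotThree (hW_three_of_T2Shape)
open Summit.QuantumFields.BalabanUV.Beta.GAN24.WSlotCauchyThree (hW_hWall_three_of_T2ShapeDrift hW_hWall_three_of_T2ShapeSupRate)

namespace Summit.QuantumFields.BalabanUV.Beta.GAN24.WSlotMixedShape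

/-! ## §1 an1's mixed table in the W-slot ENDs' binder shape (generic `d`) -/

section Generic

variable {d : ℕ} {Lc : ℕ} [NeZero Lc] {r : Fin (d + 1) → ℕ}

omit [NeZero Lc] in
/-- [folklore] The `hfm` hypothesis of the W-slot ENDs for an1's `mixFFAt`: the (field, multiplier) block vanishes (an1's `mixFFAt_inl_inr`). -/
theorem mixFFAt_hfm (ρ : Fin (d + 1) → ℤ) :
    ∀ (κ : Fin (d + 1)) (u : Fin (d + 1) → ℤ) (ρ' : Fin (d + 1)) (w x z : Fin (d + 1) → ℤ) (α μ' : Fin (d + 1)),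
      mixFFAt ρ Lc κ u ρ' w x z (Sum.inl α) (Sum.inr μ') = 0 :=
  fun κ u ρ' w x z α μ' => mixFFAt_inl_inr ρ Lc κ u ρ' w x z α μ'

omit [NeZero Lc] in
/-- [folklore] The `hm` hypothesis of the W-slot ENDs for an1's `mixFFAt`: every (multiplier, ·) block vanishes (an1's `mixFFAt_inr`). -/
theorem mixFFAt_hm (ρ : Fin (d + 1) → ℤ) :
    ∀ (κ : Fin (d + 1)) (u : Fin (d + 1) → ℤ) (ρ' : Fin (d + 1)) (w x z : Fin (d + 1) → ℤ) (μ' : Fin (d + 1)) (b : Fib d),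
      mixFFAt ρ Lc κ u ρ' w x z (Sum.inr μ') b = 0 :=
  fun κ u ρ' w x z μ' b => mixFFAt_inr ρ Lc κ u ρ' w x z μ' b

/-- **THE UNIFORM W-ROW `hW` FOR an1's MIXED TABLE, generic `d`** [folklore composition]: leaf-07's `WSlotOfShapes.hW_of_shapes` with the mixed-table
hypotheses discharged by an1's `hmix_an1` / `mixFFAt_inl_inr` / `mixFFAt_inr`; left: the K-slot decay row, «E3Shape», «T2Shape». -/
theorem hW_an1_of_shapes (hLc : 1 ≤ Lc) (hr : r ∈ box (d + 1) Lc) {C δ : ℝ} (hK : UnitDecayK d Lc (sfStep Lc) (smStep d Lc) C δ) (hδ : 0 < δ)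
    {cE cVH cΛ C₃ δ₃ : ℝ}
    (hE3 : ∀ j : ℕ, LocStencil (unitS (sfStep Lc (j + 1)) (smStep d Lc (j + 1))
      (fun κ u => (cE * wE d Lc (j + 1)) • e3Of d Lc cE cVH cΛ (j + 1) κ u)) C₃ δ₃) (hδ₃ : 0 < δ₃)
    {T₂ : ℕ → Fin (d + 1) → (Fin (d + 1) → ℤ) → Fin (d + 1) → (Fin (d + 1) → ℤ) → MKer (d + 1) (Fib d)} {C₂ δ₂ : ℝ}
    (hT₂ : ∀ j, LocStencil₂ (unitS₂ (sfStep Lc j) (smStep d Lc j) (T₂ j)) C₂ δ₂) (hδ₂ : 0 < δ₂) :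
    ∃ Cw δW : ℝ, 0 < δW ∧
      ∀ j, VertexFamily₂ (unitW (sfStep Lc j) (smStep d Lc j) (WbalOf d Lc cE cVH cΛ T₂ (mixFFAt (toSite r) Lc) j)) Lc Cw δW := by
  obtain ⟨CM₂, δ₄, hδ₄, hmix⟩ := hmix_an1 (d := d) (Lc := Lc) hLc hr
  exact hW_of_shapes hLc hK hδ hE3 hδ₃ hT₂ hδ₂ hmix hδ₄ (mixFFAt_hfm _) (mixFFAt_hm _)

/-- **THE CAUCHY W-ROW `hWall` FOR an1's MIXED TABLE, generic `d`** [folklore composition]: leaf-07's `WSlotCauchyOfShapes.hWall_of_shapes` with the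
mixed-table hypotheses discharged; left: the K-slot rows, «E3Shape» ∧ «E3Drift», «T2Shape» ∧ «T2Drift». -/
theorem hWall_an1_of_shapes (hLc : 1 ≤ Lc) (hr : r ∈ box (d + 1) Lc) {C δ cK θK : ℝ}
    (hK : UnitDecayK d Lc (sfStep Lc) (smStep d Lc) C δ) (hKall : CauchyDecayK d Lc (sfStep Lc) (smStep d Lc) cK θK δ)
    (hδ : 0 < δ) (hθK0 : 0 ≤ θK) (hθK1 : θK < 1)
    {cE cVH cΛ C₃ c₃ θ₃ δ₃ : ℝ}
    (hE3 : ∀ j : ℕ, LocStencil (unitS (sfStep Lc (j + 1)) (smStep d Lc (j + 1))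
      (fun κ u => (cE * wE d Lc (j + 1)) • e3Of d Lc cE cVH cΛ (j + 1) κ u)) C₃ δ₃)
    (hE3d : ∀ k j : ℕ, LocStencil (fun κ u =>
        unitS (sfStep Lc (k + j + 1)) (smStep d Lc (k + j + 1))
            (fun κ u => (cE * wE d Lc (k + j + 1)) • e3Of d Lc cE cVH cΛ (k + j + 1) κ u) κ u -
          unitS (sfStep Lc (k + 1)) (smStep d Lc (k + 1))
            (fun κ u => (cE * wE d Lc (k + 1)) • e3Of d Lc cE cVH cΛ (k + 1) κ u) κ u) (c₃ * θ₃ ^ k) δ₃)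
    (hθ₃ : 0 < θ₃) (hθ₃1 : θ₃ < 1) (hδ₃ : 0 < δ₃)
    {T₂ : ℕ → Fin (d + 1) → (Fin (d + 1) → ℤ) → Fin (d + 1) → (Fin (d + 1) → ℤ) → MKer (d + 1) (Fib d)} {C₂ c₂ θ₂ δ₂ : ℝ}
    (hT₂ : ∀ j, LocStencil₂ (unitS₂ (sfStep Lc j) (smStep d Lc j) (T₂ j)) C₂ δ₂)
    (hT₂d : ∀ k j, LocStencil₂ (unitS₂ (sfStep Lc (k + j)) (smStep d Lc (k + j)) (T₂ (k + j)) -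
      unitS₂ (sfStep Lc k) (smStep d Lc k) (T₂ k)) (c₂ * θ₂ ^ k) δ₂)
    (hδ₂ : 0 < δ₂) (hθ₂0 : 0 ≤ θ₂) (hθ₂1 : θ₂ < 1) :
    ∃ cW θW δW : ℝ, 0 ≤ θW ∧ θW < 1 ∧ 0 < δW ∧
      ∀ k j, VertexFamily₂ (unitW (sfStep Lc (k + j)) (smStep d Lc (k + j)) (WbalOf d Lc cE cVH cΛ T₂ (mixFFAt (toSite r) Lc) (k + j)) -
        unitW (sfStep Lc k) (smStep d Lc k) (WbalOf d Lc cE cVH cΛ T₂ (mixFFAt (toSite r) Lc) k)) Lc (cW * θW ^ k) δW := by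
  obtain ⟨CM₂, δ₄, hδ₄, hmix⟩ := hmix_an1 (d := d) (Lc := Lc) hLc hr
  exact hWall_of_shapes hLc hK hKall hδ hθK0 hθK1 hE3 hE3d hθ₃ hθ₃1 hδ₃ hT₂ hT₂d hδ₂ hθ₂0 hθ₂1 hmix hδ₄ (mixFFAt_hfm _) (mixFFAt_hm _)

/-- **BOTH W-ROWS FOR an1's MIXED TABLE AT ONE COMMON RATE, generic `d`** [folklore composition]: leaf-07's `hW_hWall_of_shapes`, mixed-table
hypotheses discharged. -/
theorem hW_hWall_an1_of_shapes (hLc : 1 ≤ Lc) (hr : r ∈ box (d + 1) Lc) {C δ cK θK : ℝ}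
    (hK : UnitDecayK d Lc (sfStep Lc) (smStep d Lc) C δ) (hKall : CauchyDecayK d Lc (sfStep Lc) (smStep d Lc) cK θK δ)
    (hδ : 0 < δ) (hθK0 : 0 ≤ θK) (hθK1 : θK < 1)
    {cE cVH cΛ C₃ c₃ θ₃ δ₃ : ℝ}
    (hE3 : ∀ j : ℕ, LocStencil (unitS (sfStep Lc (j + 1)) (smStep d Lc (j + 1))
      (fun κ u => (cE * wE d Lc (j + 1)) • e3Of d Lc cE cVH cΛ (j + 1) κ u)) C₃ δ₃)
    (hE3d : ∀ k j : ℕ, LocStencil (fun κ u =>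
        unitS (sfStep Lc (k + j + 1)) (smStep d Lc (k + j + 1))
            (fun κ u => (cE * wE d Lc (k + j + 1)) • e3Of d Lc cE cVH cΛ (k + j + 1) κ u) κ u -
          unitS (sfStep Lc (k + 1)) (smStep d Lc (k + 1))
            (fun κ u => (cE * wE d Lc (k + 1)) • e3Of d Lc cE cVH cΛ (k + 1) κ u) κ u) (c₃ * θ₃ ^ k) δ₃)
    (hθ₃ : 0 < θ₃) (hθ₃1 : θ₃ < 1) (hδ₃ : 0 < δ₃)
    {T₂ : ℕ → Fin (d + 1) → (Fin (d + 1) → ℤ) → Fin (d + 1) → (Fin (d + 1) → ℤ) → MKer (d + 1) (Fib d)} {C₂ c₂ θ₂ δ₂ : ℝ}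
    (hT₂ : ∀ j, LocStencil₂ (unitS₂ (sfStep Lc j) (smStep d Lc j) (T₂ j)) C₂ δ₂)
    (hT₂d : ∀ k j, LocStencil₂ (unitS₂ (sfStep Lc (k + j)) (smStep d Lc (k + j)) (T₂ (k + j)) -
      unitS₂ (sfStep Lc k) (smStep d Lc k) (T₂ k)) (c₂ * θ₂ ^ k) δ₂)
    (hδ₂ : 0 < δ₂) (hθ₂0 : 0 ≤ θ₂) (hθ₂1 : θ₂ < 1) :
    ∃ Cw cW θW δW : ℝ, 0 ≤ θW ∧ θW < 1 ∧ 0 < δW ∧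
      (∀ j, VertexFamily₂ (unitW (sfStep Lc j) (smStep d Lc j) (WbalOf d Lc cE cVH cΛ T₂ (mixFFAt (toSite r) Lc) j)) Lc Cw δW) ∧
      (∀ k j, VertexFamily₂ (unitW (sfStep Lc (k + j)) (smStep d Lc (k + j)) (WbalOf d Lc cE cVH cΛ T₂ (mixFFAt (toSite r) Lc) (k + j)) -
        unitW (sfStep Lc k) (smStep d Lc k) (WbalOf d Lc cE cVH cΛ T₂ (mixFFAt (toSite r) Lc) k)) Lc (cW * θW ^ k) δW) := by
  obtain ⟨CM₂, δ₄, hδ₄, hmix⟩ := hmix_an1 (d := d) (Lc := Lc) hLc hr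
  exact hW_hWall_of_shapes hLc hK hKall hδ hθK0 hθK1 hE3 hE3d hθ₃ hθ₃1 hδ₃ hT₂ hT₂d hδ₂ hθ₂0 hθ₂1 hmix hδ₄ (mixFFAt_hfm _) (mixFFAt_hm _)

end Generic

/-! ## §2 `d = 3`, `Lc ≥ 2`: the W-rows for an1's mixed table wait on the T₂ slot only -/

section Three

variable {Lc : ℕ} [NeZero Lc] {r : Fin (3 + 1) → ℕ}

/-- **THE UNIFORM W-ROW AT `d = 3`, `Lc ≥ 2`, FOR an1's MIXED TABLE, FROM «T2Shape» ALONE** [folklore composition]: `WSlotThree.hW_three_of_T2Shape`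
(K-slot and «E3Shape» inside) with the mixed-table hypotheses discharged. -/
theorem hW_three_an1_of_T2Shape (hLc : 2 ≤ Lc) (hr : r ∈ box (3 + 1) Lc) (cE cVH cΛ : ℝ)
    {T₂ : ℕ → Fin (3 + 1) → (Fin (3 + 1) → ℤ) → Fin (3 + 1) → (Fin (3 + 1) → ℤ) → MKer (3 + 1) (Fib 3)} {C₂ δ₂ : ℝ}
    (hT₂ : ∀ j, LocStencil₂ (unitS₂ (sfStep Lc j) (smStep 3 Lc j) (T₂ j)) C₂ δ₂) (hδ₂ : 0 < δ₂) :
    ∃ Cw δW : ℝ, 0 < δW ∧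
      ∀ j, VertexFamily₂ (unitW (sfStep Lc j) (smStep 3 Lc j) (WbalOf 3 Lc cE cVH cΛ T₂ (mixFFAt (toSite r) Lc) j)) Lc Cw δW := by
  obtain ⟨CM₂, δ₄, hδ₄, hmix⟩ := hmix_an1 (d := 3) (Lc := Lc) (one_le_of_two_le hLc) hr
  exact hW_three_of_T2Shape hLc cE cVH cΛ hT₂ hδ₂ hmix hδ₄ (mixFFAt_hfm _) (mixFFAt_hm _)

/-- **BOTH W-ROWS AT `d = 3`, `Lc ≥ 2`, FOR an1's MIXED TABLE, FROM «T2Shape» ∧ «T2Drift» ALONE** [folklore composition]: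
`WSlotCauchyThree.hW_hWall_three_of_T2ShapeDrift` with the mixed-table hypotheses discharged — the binders `(hW₂, hW₂all, hδW, hθW0, hθW1)` of
`StencilSlotWallThree.d1Drift_JsBalOf_iff_three_of_wRows` for `W := WbalOf 3 Lc cE cVH cΛ T₂ (mixFFAt (toSite r) Lc)`. -/
theorem hW_hWall_three_an1_of_T2ShapeDrift (hLc : 2 ≤ Lc) (hr : r ∈ box (3 + 1) Lc) (cE cVH cΛ : ℝ)
    {T₂ : ℕ → Fin (3 + 1) → (Fin (3 + 1) → ℤ) → Fin (3 + 1) → (Fin (3 + 1) → ℤ) → MKer (3 + 1) (Fib 3)} {C₂ c₂ θ₂ δ₂ : ℝ}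
    (hT₂ : ∀ j, LocStencil₂ (unitS₂ (sfStep Lc j) (smStep 3 Lc j) (T₂ j)) C₂ δ₂)
    (hT₂d : ∀ k j, LocStencil₂ (unitS₂ (sfStep Lc (k + j)) (smStep 3 Lc (k + j)) (T₂ (k + j)) -
      unitS₂ (sfStep Lc k) (smStep 3 Lc k) (T₂ k)) (c₂ * θ₂ ^ k) δ₂)
    (hδ₂ : 0 < δ₂) (hθ₂0 : 0 ≤ θ₂) (hθ₂1 : θ₂ < 1) :
    ∃ Cw cW θW δW : ℝ, 0 ≤ θW ∧ θW < 1 ∧ 0 < δW ∧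
      (∀ j, VertexFamily₂ (unitW (sfStep Lc j) (smStep 3 Lc j) (WbalOf 3 Lc cE cVH cΛ T₂ (mixFFAt (toSite r) Lc) j)) Lc Cw δW) ∧
      (∀ k j, VertexFamily₂ (unitW (sfStep Lc (k + j)) (smStep 3 Lc (k + j)) (WbalOf 3 Lc cE cVH cΛ T₂ (mixFFAt (toSite r) Lc) (k + j)) -
        unitW (sfStep Lc k) (smStep 3 Lc k) (WbalOf 3 Lc cE cVH cΛ T₂ (mixFFAt (toSite r) Lc) k)) Lc (cW * θW ^ k) δW) := by
  obtain ⟨CM₂, δ₄, hδ₄, hmix⟩ := hmix_an1 (d := 3) (Lc := Lc) (one_le_of_two_le hLc) hr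
  exact hW_hWall_three_of_T2ShapeDrift hLc cE cVH cΛ hT₂ hT₂d hδ₂ hθ₂0 hθ₂1 hmix hδ₄ (mixFFAt_hfm _) (mixFFAt_hm _)

/-- **BOTH W-ROWS AT `d = 3`, `Lc ≥ 2`, FOR an1's MIXED TABLE, FROM «T2Shape» ∧ «T2SupRate» ALONE** [folklore composition]:
`WSlotCauchyThree.hW_hWall_three_of_T2ShapeSupRate` with the mixed-table hypotheses discharged — the socket the owner's road «W3» ENDs serve,
with NO other hypothesis left for the cell's family. -/
theorem hW_hWall_three_an1_of_T2ShapeSupRate (hLc : 2 ≤ Lc) (hr : r ∈ box (3 + 1) Lc) (cE cVH cΛ : ℝ)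
    {T₂ : ℕ → Fin (3 + 1) → (Fin (3 + 1) → ℤ) → Fin (3 + 1) → (Fin (3 + 1) → ℤ) → MKer (3 + 1) (Fib 3)} {C₂ δ₂ c θ : ℝ}
    (hT₂ : ∀ j, LocStencil₂ (unitS₂ (sfStep Lc j) (smStep 3 Lc j) (T₂ j)) C₂ δ₂) (hδ₂ : 0 < δ₂)
    (hR : ∀ (n : ℕ) (κ : Fin (3 + 1)) (u : Fin (3 + 1) → ℤ) (κ' : Fin (3 + 1)) (u' : Fin (3 + 1) → ℤ),
      SupBound (unitS₂ (sfStep Lc (n + 1)) (smStep 3 Lc (n + 1)) (T₂ (n + 1)) κ u κ' u' - unitS₂ (sfStep Lc n) (smStep 3 Lc n) (T₂ n) κ u κ' u')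
        (c * θ ^ n))
    (hc : 0 ≤ c) (hθ0 : 0 ≤ θ) (hθ1 : θ < 1) :
    ∃ Cw cW θW δW : ℝ, 0 ≤ θW ∧ θW < 1 ∧ 0 < δW ∧
      (∀ j, VertexFamily₂ (unitW (sfStep Lc j) (smStep 3 Lc j) (WbalOf 3 Lc cE cVH cΛ T₂ (mixFFAt (toSite r) Lc) j)) Lc Cw δW) ∧
      (∀ k j, VertexFamily₂ (unitW (sfStep Lc (k + j)) (smStep 3 Lc (k + j)) (WbalOf 3 Lc cE cVH cΛ T₂ (mixFFAt (toSite r) Lc) (k + j)) -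
        unitW (sfStep Lc k) (smStep 3 Lc k) (WbalOf 3 Lc cE cVH cΛ T₂ (mixFFAt (toSite r) Lc) k)) Lc (cW * θW ^ k) δW) := by
  obtain ⟨CM₂, δ₄, hδ₄, hmix⟩ := hmix_an1 (d := 3) (Lc := Lc) (one_le_of_two_le hLc) hr
  exact hW_hWall_three_of_T2ShapeSupRate hLc cE cVH cΛ hT₂ hδ₂ hR hc hθ0 hθ1 hmix hδ₄ (mixFFAt_hfm _) (mixFFAt_hm _)

end Three

/-! ## §3 The cell's Stage-B family: `WbalT2Of` with an1's tables (`T₂ := T2Of …`, by `rfl`), any box root and the centred root -/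

section StageB

variable {Lc : ℕ} [NeZero Lc] {r : Fin (3 + 1) → ℕ}

/-- **BOTH W-ROWS FOR an2's STAGE-B FAMILY WITH an1's TABLES PLUGGED IN** (`WbalT2Of … (vh₂S := vh₂SAt (toSite r) Lc) (mixFF := mixFFAt (toSite r) Lc)`,
the `W`-component of `MixedJetTablesPlug.JsBalAn1`), `d = 3`, `Lc ≥ 2`, FROM «T2Shape» ∧ «T2SupRate» OF THE RECURSIVE TABLES `T2Of …` ALONE
[folklore composition; `WbalT2Of` unfolds to `WbalOf … (T2Of …) mixFF` by `rfl`]. -/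
theorem hW_hWall_three_stageB_of_T2ShapeSupRate (hLc : 2 ≤ Lc) (hr : r ∈ box (3 + 1) Lc) (cE cVH cΛ cE₂ cB : ℝ)
    (T : Fin 4 → Fin 4 → Fin 4 → Fin 4 → ℝ) {C₂ δ₂ c θ : ℝ}
    (hT₂ : ∀ j, LocStencil₂ (unitS₂ (sfStep Lc j) (smStep 3 Lc j)
      (T2Of 3 Lc cE cVH cΛ cE₂ cB T (vh₂SAt (toSite r) Lc) (mixFFAt (toSite r) Lc) j)) C₂ δ₂) (hδ₂ : 0 < δ₂)
    (hR : ∀ (n : ℕ) (κ : Fin (3 + 1)) (u : Fin (3 + 1) → ℤ) (κ' : Fin (3 + 1)) (u' : Fin (3 + 1) → ℤ),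
      SupBound (unitS₂ (sfStep Lc (n + 1)) (smStep 3 Lc (n + 1))
          (T2Of 3 Lc cE cVH cΛ cE₂ cB T (vh₂SAt (toSite r) Lc) (mixFFAt (toSite r) Lc) (n + 1)) κ u κ' u' -
        unitS₂ (sfStep Lc n) (smStep 3 Lc n) (T2Of 3 Lc cE cVH cΛ cE₂ cB T (vh₂SAt (toSite r) Lc) (mixFFAt (toSite r) Lc) n) κ u κ' u')
        (c * θ ^ n))
    (hc : 0 ≤ c) (hθ0 : 0 ≤ θ) (hθ1 : θ < 1) :
    ∃ Cw cW θW δW : ℝ, 0 ≤ θW ∧ θW < 1 ∧ 0 < δW ∧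
      (∀ j, VertexFamily₂ (unitW (sfStep Lc j) (smStep 3 Lc j)
        (WbalT2Of (Lc := Lc) cE cVH cΛ cE₂ cB T (vh₂S := vh₂SAt (toSite r) Lc) (mixFF := mixFFAt (toSite r) Lc) j)) Lc Cw δW) ∧
      (∀ k j, VertexFamily₂ (unitW (sfStep Lc (k + j)) (smStep 3 Lc (k + j))
          (WbalT2Of (Lc := Lc) cE cVH cΛ cE₂ cB T (vh₂S := vh₂SAt (toSite r) Lc) (mixFF := mixFFAt (toSite r) Lc) (k + j)) -
        unitW (sfStep Lc k) (smStep 3 Lc k)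
          (WbalT2Of (Lc := Lc) cE cVH cΛ cE₂ cB T (vh₂S := vh₂SAt (toSite r) Lc) (mixFF := mixFFAt (toSite r) Lc) k)) Lc (cW * θW ^ k) δW) :=
  hW_hWall_three_an1_of_T2ShapeSupRate hLc hr cE cVH cΛ hT₂ hδ₂ hR hc hθ0 hθ1

/-- **THE CENTRED ROOT** (`r := ctrOff (3+1) Lc`, the root of `MixedJetTablesPlug.JsBalAn1Ctr`; `ctrOff_mem_box`): both W-rows for the Stage-B family
from «T2Shape» ∧ «T2SupRate» of its recursive tables alone. -/
theorem hW_hWall_three_ctr_of_T2ShapeSupRate (hLc : 2 ≤ Lc) (cE cVH cΛ cE₂ cB : ℝ) (T : Fin 4 → Fin 4 → Fin 4 → Fin 4 → ℝ) {C₂ δ₂ c θ : ℝ}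
    (hT₂ : ∀ j, LocStencil₂ (unitS₂ (sfStep Lc j) (smStep 3 Lc j)
      (T2Of 3 Lc cE cVH cΛ cE₂ cB T (vh₂SAt (toSite (ctrOff (3 + 1) Lc)) Lc) (mixFFAt (toSite (ctrOff (3 + 1) Lc)) Lc) j)) C₂ δ₂)
    (hδ₂ : 0 < δ₂)
    (hR : ∀ (n : ℕ) (κ : Fin (3 + 1)) (u : Fin (3 + 1) → ℤ) (κ' : Fin (3 + 1)) (u' : Fin (3 + 1) → ℤ),
      SupBound (unitS₂ (sfStep Lc (n + 1)) (smStep 3 Lc (n + 1))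
          (T2Of 3 Lc cE cVH cΛ cE₂ cB T (vh₂SAt (toSite (ctrOff (3 + 1) Lc)) Lc) (mixFFAt (toSite (ctrOff (3 + 1) Lc)) Lc) (n + 1)) κ u κ' u' -
        unitS₂ (sfStep Lc n) (smStep 3 Lc n)
          (T2Of 3 Lc cE cVH cΛ cE₂ cB T (vh₂SAt (toSite (ctrOff (3 + 1) Lc)) Lc) (mixFFAt (toSite (ctrOff (3 + 1) Lc)) Lc) n) κ u κ' u')
        (c * θ ^ n))
    (hc : 0 ≤ c) (hθ0 : 0 ≤ θ) (hθ1 : θ < 1) :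
    ∃ Cw cW θW δW : ℝ, 0 ≤ θW ∧ θW < 1 ∧ 0 < δW ∧
      (∀ j, VertexFamily₂ (unitW (sfStep Lc j) (smStep 3 Lc j)
        (WbalT2Of (Lc := Lc) cE cVH cΛ cE₂ cB T (vh₂S := vh₂SAt (toSite (ctrOff (3 + 1) Lc)) Lc)
          (mixFF := mixFFAt (toSite (ctrOff (3 + 1) Lc)) Lc) j)) Lc Cw δW) ∧
      (∀ k j, VertexFamily₂ (unitW (sfStep Lc (k + j)) (smStep 3 Lc (k + j))
          (WbalT2Of (Lc := Lc) cE cVH cΛ cE₂ cB T (vh₂S := vh₂SAt (toSite (ctrOff (3 + 1) Lc)) Lc)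
            (mixFF := mixFFAt (toSite (ctrOff (3 + 1) Lc)) Lc) (k + j)) -
        unitW (sfStep Lc k) (smStep 3 Lc k)
          (WbalT2Of (Lc := Lc) cE cVH cΛ cE₂ cB T (vh₂S := vh₂SAt (toSite (ctrOff (3 + 1) Lc)) Lc)
            (mixFF := mixFFAt (toSite (ctrOff (3 + 1) Lc)) Lc) k)) Lc (cW * θW ^ k) δW) :=
  hW_hWall_three_stageB_of_T2ShapeSupRate hLc (ctrOff_mem_box (one_le_of_two_le hLc)) cE cVH cΛ cE₂ cB T hT₂ hδ₂ hR hc hθ0 hθ1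

end StageB

end Summit.QuantumFields.BalabanUV.Beta.GAN24.WSlotMixedShape

end
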